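import Summits.HubbardSuperconductivity.HubbardSuperconductivity.Theses.ThermalWedge
import Literature.MathematicalPhysics.QuantumLattice.DWaveSourceFreeGainBound
import Literature.MathematicalPhysics.QuantumLattice.TorusCooperSum
import Summits.HubbardSuperconductivity.HubbardSuperconductivity.Theorems.ThermalWedgeTwSourcedInertnessReduction
import Summits.HubbardSuperconductivity.HubbardSuperconductivity.Theorems.TwSourcedInertness.Negative.FreeGain

/-!
# Crux `TwSourcedCondensation` (item `stmt-HubbardSuperconductivity-1697`): the lead's free THERMAL-LAW stub —
the source is decorative and `∃ L₀(β,μ)` is load-bearing (TARGETS of the standing disprover, generation 3)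

`--supports` file; no definition introduced. Stub (Fh) `stub_freeLinearThermalLaw` of the line
`entropy-staircase-linear-regime` (skeleton `f819e3d0`): `p̃₀(β/2,h) - p̃₀(β,h) ≤ C₁/β²` on `|h| ≤ 1/β`,
`∃ L₀` after `β, μ` (`p̃₀(β,h) = log Re Z_β(dWaveSourceTorus L 0 μ h)/(βL²)`). It SURVIVES as stated. Proved:

* `log_partitionFn_free`, `two_log_half_sub_log_free` — exact free `log Z` (tree BdG product) and the dyadic
  identity `2 log Z_{β/2}(s) - log Z_β(s) = 2L² log 2 + Σ_k ψ_k`,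
  `ψ_k = 2 log((1+cosh(βE_k/2))/2) - log((1+cosh βE_k)/2) ∈ [-2 log 2, 0]` (`dyadicMode_ge`);
* `dyadicMode_antitone`, `free_heatChord_le_zero_source` — `ψ` is non-increasing in `E ≥ 0`, so THE SOURCE
  IS DECORATIVE in (Fh): `p̃₀(β/2,s) - p̃₀(β,s) ≤ p̃₀(β/2,0) - p̃₀(β,0)` for every real `s`; (Fh) need only be
  proved for the number-conserving free gas (`h = 0`, a Sommerfeld bound);
* `free_heatChord_ge_of_zeroMode` — a torus with an exact zero mode (`ε_L(q) = μ`) has heat chord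
  `≥ 2 log 2/(βL²)` at `h = 0` (the `3j`-torus has the level `-1` through `(j,0)`: REUSED from the sibling
  crux's `Theorems/TwSourcedInertness/Negative/FreeGain.torusBand_qOn`);
* `stub_freeLinearThermalLaw_false_uniformL0` — (Fh) with `L₀` chosen BEFORE `β, μ` is FALSE (witness
  `μ₁ = μ₂ = -1`, `L = 3·max(L₀,1)`, `h = 0`, `β = C₁L²/log 2 + 1`): `L₀(β,-1)² ≳ β/C₁` is forced.
Tree: `partitionFn_dWaveSourceTorus_zero_re`, `bdgModeFactor_pos`, `one_add_cosh`, `card_orb_fermionTorus_two`,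
`card_torusSite_two`, `TwSourcedInertness.Negative.torusBand_qOn`.
-/

noncomputable section

namespace Summit.HubbardSuperconductivity.HubbardSuperconductivity.Theorems.TwSourcedCondensation.Negative

open Matrix Finset Literature.MathematicalPhysics.QuantumLattice Literature.Probability.LatticeModels
open Summit.HubbardSuperconductivity.HubbardSuperconductivity.Theorems
open scoped Matrix.Norms.L2Operator ComplexOrder

/-- Exact free `log Z` at ANY source (`L ≥ 3`):
`log Z_β(H_L(0,μ,s)) = 2L² log 2 + Σ_k [-βξ_k + log((1 + cosh βE_k(s))/2)]`. [folklore] -/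
theorem log_partitionFn_free (L : ℕ) [NeZero L] (hL : 3 ≤ L) (β μ s : ℝ) :
    Real.log (partitionFn β (dWaveSourceTorus L 0 μ s)).re =
      (Fintype.card (Orb (FermionTorus 2 L)) : ℝ) * Real.log 2 +
        ∑ k : TorusSite 2 L, (-(β * (torusBand L k - μ)) +
          Real.log ((1 + Real.cosh (β * Real.sqrt ((torusBand L k - μ) ^ 2 +
            (2 * Real.sqrt 2 * s * dWaveGap k) ^ 2))) / 2)) := by
  rw [partitionFn_dWaveSourceTorus_zero_re hL β μ s]
  have hpow : (0 : ℝ) < (2 : ℝ) ^ Fintype.card (Orb (FermionTorus 2 L)) := by positivity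
  have hfac : ∀ k : TorusSite 2 L, Real.exp (-(β * (torusBand L k - μ))) *
      ((1 + Real.cosh (β * Real.sqrt ((torusBand L k - μ) ^ 2 + (2 * Real.sqrt 2 * s * dWaveGap k) ^ 2))) / 2) ≠ 0 :=
    fun k => (bdgModeFactor_pos β _ _).ne'
  rw [Real.log_mul hpow.ne' (Finset.prod_ne_zero_iff.2 fun k _ => hfac k), Real.log_pow,
    Real.log_prod (hf := fun k _ => hfac k)]
  congr 1
  refine Finset.sum_congr rfl fun k _ => ?_
  have hcosh : 0 < (1 + Real.cosh (β * Real.sqrt ((torusBand L k - μ) ^ 2 +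
      (2 * Real.sqrt 2 * s * dWaveGap k) ^ 2))) / 2 := by
    have := Real.one_le_cosh (β * Real.sqrt ((torusBand L k - μ) ^ 2 + (2 * Real.sqrt 2 * s * dWaveGap k) ^ 2))
    positivity
  rw [Real.log_mul (Real.exp_pos _).ne' hcosh.ne', Real.log_exp]

/-- The dyadic per-mode function `ψ = 2 log((1+cosh(βS/2))/2) - log((1+cosh βS)/2)` is `≥ -2 log 2`
(`cosh²(y/2) ≤ (1 + cosh(y/2))²`). [folklore] -/
theorem dyadicMode_ge (β S : ℝ) :
    -(2 * Real.log 2) ≤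
      2 * Real.log ((1 + Real.cosh (β / 2 * S)) / 2) - Real.log ((1 + Real.cosh (β * S)) / 2) := by
  have hc := Real.one_le_cosh (β / 2 * S)
  have hpos2 : 0 < (1 + Real.cosh (β / 2 * S)) / 2 := by positivity
  have hpos1 : 0 < (1 + Real.cosh (β * S)) / 2 := by have := Real.one_le_cosh (β * S); positivity
  have key : (1 + Real.cosh (β * S)) / 2 ≤ (2 * ((1 + Real.cosh (β / 2 * S)) / 2)) ^ 2 := by
    rw [one_add_cosh (β * S), show β * S / 2 = β / 2 * S by ring]
    nlinarith
  have := Real.log_le_log hpos1 key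
  rw [Real.log_pow, Real.log_mul two_ne_zero hpos2.ne'] at this
  push_cast at this
  linarith

/-- Sum bookkeeping: `2(A + Σa) - (A + Σb) = A + Σc` when `2a_k - b_k = c_k`. [folklore] -/
theorem two_mul_add_sum_sub {ι : Type*} [Fintype ι] (A : ℝ) (a b c : ι → ℝ)
    (h : ∀ k, 2 * a k - b k = c k) :
    2 * (A + ∑ k, a k) - (A + ∑ k, b k) = A + ∑ k, c k := by
  rw [← Finset.sum_congr rfl fun k _ => h k, Finset.sum_sub_distrib, ← Finset.mul_sum]
  ring

/-- **Exact dyadic identity for the free heat chord numerator** (`L ≥ 3`, any source `s`):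
`2 log Z_{β/2}(s) - log Z_β(s) = 2L² log 2 + Σ_k ψ_k`, `ψ_k = 2 log((1+cosh(βE_k/2))/2) - log((1+cosh βE_k)/2)`.
[folklore] -/
theorem two_log_half_sub_log_free (L : ℕ) [NeZero L] (hL : 3 ≤ L) (β μ s : ℝ) :
    2 * Real.log (partitionFn (β / 2) (dWaveSourceTorus L 0 μ s)).re -
        Real.log (partitionFn β (dWaveSourceTorus L 0 μ s)).re =
      (Fintype.card (Orb (FermionTorus 2 L)) : ℝ) * Real.log 2 +
        ∑ k : TorusSite 2 L,
          (2 * Real.log ((1 + Real.cosh (β / 2 * Real.sqrt ((torusBand L k - μ) ^ 2 +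
              (2 * Real.sqrt 2 * s * dWaveGap k) ^ 2))) / 2) -
            Real.log ((1 + Real.cosh (β * Real.sqrt ((torusBand L k - μ) ^ 2 +
              (2 * Real.sqrt 2 * s * dWaveGap k) ^ 2))) / 2)) := by
  rw [log_partitionFn_free L hL, log_partitionFn_free L hL]
  refine two_mul_add_sum_sub _ _ _ _ fun k => ?_
  ring

/-- **The free heat chord of a torus with a zero mode is at least `2 log 2/(βL²)`** (`L ≥ 3`, `h = 0`,
`ε_L(q) = μ`): every exact zero mode keeps entropy `2 log 2` down to `T = 0`. [folklore] -/
theorem free_heatChord_ge_of_zeroMode (L : ℕ) [NeZero L] (hL : 3 ≤ L) {μ : ℝ} (q : TorusSite 2 L)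
    (hq : torusBand L q = μ) {β : ℝ} (hβ : 0 < β) :
    2 * Real.log 2 / (β * (L : ℝ) ^ 2) ≤ (Real.log (partitionFn (β / 2) (dWaveSourceTorus L 0 μ 0)).re / ((β / 2) * (L : ℝ) ^ 2)) - (Real.log (partitionFn β (dWaveSourceTorus L 0 μ 0)).re / (β * (L : ℝ) ^ 2)) := by
  have hL2 : (0 : ℝ) < (L : ℝ) ^ 2 := cast_sq_pos_of_neZero L
  have hden : 0 < β * (L : ℝ) ^ 2 := mul_pos hβ hL2
  have hchord : (Real.log (partitionFn (β / 2) (dWaveSourceTorus L 0 μ 0)).re / ((β / 2) * (L : ℝ) ^ 2)) - (Real.log (partitionFn β (dWaveSourceTorus L 0 μ 0)).re / (β * (L : ℝ) ^ 2)) =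
      (2 * Real.log (partitionFn (β / 2) (dWaveSourceTorus L 0 μ 0)).re -
        Real.log (partitionFn β (dWaveSourceTorus L 0 μ 0)).re) / (β * (L : ℝ) ^ 2) := by
    field_simp
  rw [hchord, two_log_half_sub_log_free L hL]
  refine div_le_div_of_nonneg_right ?_ hden.le
  -- the sum: `ψ_q = 0`, `ψ_k ≥ -2 log 2` elsewhere, `card Orb = 2L²`
  set ψ : TorusSite 2 L → ℝ := fun k =>
    2 * Real.log ((1 + Real.cosh (β / 2 * Real.sqrt ((torusBand L k - μ) ^ 2 +
        (2 * Real.sqrt 2 * 0 * dWaveGap k) ^ 2))) / 2) -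
      Real.log ((1 + Real.cosh (β * Real.sqrt ((torusBand L k - μ) ^ 2 +
        (2 * Real.sqrt 2 * 0 * dWaveGap k) ^ 2))) / 2) with hψ
  have hψq : ψ q = 0 := by
    simp only [hψ, hq, sub_self, mul_zero, zero_mul, ne_eq, OfNat.ofNat_ne_zero, not_false_eq_true,
      zero_pow, add_zero, Real.sqrt_zero, Real.cosh_zero]
    norm_num
  have hψk : ∀ k, -(2 * Real.log 2) ≤ ψ k := fun k => dyadicMode_ge β _
  have hsum : -(2 * Real.log 2) * ((L : ℝ) ^ 2 - 1) ≤ ∑ k, ψ k := by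
    rw [← Finset.add_sum_erase Finset.univ ψ (Finset.mem_univ q), hψq, zero_add]
    have hcard : ((Finset.univ.erase q).card : ℝ) = (L : ℝ) ^ 2 - 1 := by
      rw [Finset.card_erase_of_mem (Finset.mem_univ q), Finset.card_univ, card_torusSite_two]
      have : 1 ≤ L ^ 2 := Nat.one_le_pow _ _ (Nat.pos_of_ne_zero (NeZero.ne L))
      push_cast [Nat.cast_sub this]
      ring
    calc -(2 * Real.log 2) * ((L : ℝ) ^ 2 - 1) = ∑ _k ∈ Finset.univ.erase q, -(2 * Real.log 2) := by
          rw [Finset.sum_const, nsmul_eq_mul, hcard]; ring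
      _ ≤ ∑ k ∈ Finset.univ.erase q, ψ k := Finset.sum_le_sum fun k _ => hψk k
  have hcardOrb : (Fintype.card (Orb (FermionTorus 2 L)) : ℝ) = 2 * (L : ℝ) ^ 2 := by
    rw [card_orb_fermionTorus_two]; push_cast; ring
  change 2 * Real.log 2 ≤ (Fintype.card (Orb (FermionTorus 2 L)) : ℝ) * Real.log 2 + ∑ k, ψ k
  rw [hcardOrb]
  nlinarith [Real.log_pos one_lt_two]

/-- The dyadic per-mode function is ANTITONE in the quasi-particle energy: for `β ≥ 0` and
`0 ≤ E ≤ E'`, `ψ(E') ≤ ψ(E)` where `ψ(E) = 2 log((1+cosh(βE/2))/2) - log((1+cosh βE)/2)`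
(`ψ = 2 log(u²/(2u²-1))`, `u = cosh(βE/4) ≥ 1` increasing in `E`, `u²/(2u²-1)` decreasing in `u`). [folklore] -/
theorem dyadicMode_antitone {β E E' : ℝ} (hβ : 0 ≤ β) (hE : 0 ≤ E) (hEE' : E ≤ E') :
    2 * Real.log ((1 + Real.cosh (β / 2 * E')) / 2) - Real.log ((1 + Real.cosh (β * E')) / 2) ≤
      2 * Real.log ((1 + Real.cosh (β / 2 * E)) / 2) - Real.log ((1 + Real.cosh (β * E)) / 2) := by
  -- `u = cosh(βE/4)`, `u' = cosh(βE'/4)`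
  set u : ℝ := Real.cosh (β / 2 * E / 2) with hu
  set u' : ℝ := Real.cosh (β / 2 * E' / 2) with hu'
  have hu1 : 1 ≤ u := Real.one_le_cosh _
  have hu'1 : 1 ≤ u' := Real.one_le_cosh _
  have hE' : 0 ≤ E' := hE.trans hEE'
  have huu' : u ≤ u' := by
    rw [hu, hu', Real.cosh_le_cosh, abs_of_nonneg (by positivity), abs_of_nonneg (by positivity)]
    have := mul_le_mul_of_nonneg_left hEE' hβ
    linarith
  -- the four `(1 + cosh)/2` factors through `u, u'`
  have hA : (1 + Real.cosh (β / 2 * E)) / 2 = u ^ 2 := by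
    rw [one_add_cosh (β / 2 * E)]; ring
  have hA' : (1 + Real.cosh (β / 2 * E')) / 2 = u' ^ 2 := by
    rw [one_add_cosh (β / 2 * E')]; ring
  have hB : (1 + Real.cosh (β * E)) / 2 = (2 * u ^ 2 - 1) ^ 2 := by
    rw [one_add_cosh (β * E)]
    have : Real.cosh (β * E / 2) = 2 * u ^ 2 - 1 := by
      have h1 := one_add_cosh (β * E / 2)
      rw [show β * E / 2 / 2 = β / 2 * E / 2 by ring] at h1
      linarith
    rw [this]; ring
  have hB' : (1 + Real.cosh (β * E')) / 2 = (2 * u' ^ 2 - 1) ^ 2 := by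
    rw [one_add_cosh (β * E')]
    have : Real.cosh (β * E' / 2) = 2 * u' ^ 2 - 1 := by
      have h1 := one_add_cosh (β * E' / 2)
      rw [show β * E' / 2 / 2 = β / 2 * E' / 2 by ring] at h1
      linarith
    rw [this]; ring
  rw [hA, hA', hB, hB']
  have hupos : 0 < u := by linarith
  have hu'pos : 0 < u' := by linarith
  have hv : 0 < 2 * u ^ 2 - 1 := by nlinarith
  have hv' : 0 < 2 * u' ^ 2 - 1 := by nlinarith
  rw [Real.log_pow, Real.log_pow, Real.log_pow, Real.log_pow]
  push_cast
  -- reduce to `log(u'²... )`: `2·2 log u' - 2 log(2u'²-1) ≤ 2·2 log u - 2 log(2u²-1)`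
  have key : Real.log (u' ^ 2 / (2 * u' ^ 2 - 1)) ≤ Real.log (u ^ 2 / (2 * u ^ 2 - 1)) := by
    refine Real.log_le_log (by positivity) ?_
    rw [div_le_div_iff₀ hv' hv]
    nlinarith [mul_le_mul huu' huu' hupos.le hu'pos.le]
  rw [Real.log_div (by positivity) hv'.ne', Real.log_div (by positivity) hv.ne', Real.log_pow,
    Real.log_pow] at key
  push_cast at key
  linarith

/-- **In stub (Fh) the source is DECORATIVE: the free heat chord is maximal at `h = 0`.** For `L ≥ 3`,
`β > 0`, all `μ` and every real source `s`:
`p̃₀(β/2,s) - p̃₀(β,s) ≤ p̃₀(β/2,0) - p̃₀(β,0)` (the BdG energies `E_k(s) ≥ |ξ_k|` only lower the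
dyadic entropy increment, mode by mode). So (Fh) need only be proved for the number-conserving free
gas at `h = 0` (a Sommerfeld bound); the window `|h| ≤ 1/β` plays no role in it. [folklore] -/
theorem free_heatChord_le_zero_source (L : ℕ) [NeZero L] (hL : 3 ≤ L) {β : ℝ} (hβ : 0 < β)
    (μ s : ℝ) :
    (Real.log (partitionFn (β / 2) (dWaveSourceTorus L 0 μ s)).re / ((β / 2) * (L : ℝ) ^ 2)) - (Real.log (partitionFn β (dWaveSourceTorus L 0 μ s)).re / (β * (L : ℝ) ^ 2)) ≤ (Real.log (partitionFn (β / 2) (dWaveSourceTorus L 0 μ 0)).re / ((β / 2) * (L : ℝ) ^ 2)) - (Real.log (partitionFn β (dWaveSourceTorus L 0 μ 0)).re / (β * (L : ℝ) ^ 2)) := by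
  have hL2 : (0 : ℝ) < (L : ℝ) ^ 2 := cast_sq_pos_of_neZero L
  have hden : 0 < β * (L : ℝ) ^ 2 := mul_pos hβ hL2
  have hchord : ∀ t : ℝ, (Real.log (partitionFn (β / 2) (dWaveSourceTorus L 0 μ t)).re / ((β / 2) * (L : ℝ) ^ 2)) - (Real.log (partitionFn β (dWaveSourceTorus L 0 μ t)).re / (β * (L : ℝ) ^ 2)) =
      (2 * Real.log (partitionFn (β / 2) (dWaveSourceTorus L 0 μ t)).re -
        Real.log (partitionFn β (dWaveSourceTorus L 0 μ t)).re) / (β * (L : ℝ) ^ 2) := by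
    intro t
    field_simp
  rw [hchord s, hchord 0, two_log_half_sub_log_free L hL, two_log_half_sub_log_free L hL]
  refine div_le_div_of_nonneg_right ?_ hden.le
  rw [add_le_add_iff_left]
  apply Finset.sum_le_sum
  intro k _
  refine dyadicMode_antitone hβ.le (Real.sqrt_nonneg _) (Real.sqrt_le_sqrt ?_)
  have h0 : (2 * Real.sqrt 2 * (0 : ℝ) * dWaveGap k) ^ 2 = 0 := by ring
  rw [h0]
  nlinarith [sq_nonneg (2 * Real.sqrt 2 * s * dWaveGap k)]

/-- **TARGET (Fh): the `L₀`-uniform free thermal law is FALSE** (stub (Fh) with `∃ L₀` before `β, μ`):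
at `μ = -1` every `3j`-torus has a zero mode whose entropy `2 log 2` survives to `T = 0`, so the heat
chord is `≥ 2 log 2/(βL²) > C₁/β²` for `β > C₁L²/(2 log 2)`. Witness: `μ₁ = μ₂ = -1`, `L = 3·max(L₀,1)`,
`h = 0`, `β = C₁L²/log 2 + 1`. MESSAGE: in (Fh) too `L₀(β,μ)` must grow with `β` (`L₀(β,-1)² ≳ β/C₁`). [folklore] -/
theorem stub_freeLinearThermalLaw_false_uniformL0 :
    ¬ (∀ μ₁ μ₂ : ℝ, -4 < μ₁ → μ₁ ≤ μ₂ → μ₂ < 0 → ∃ C₁ : ℝ, ∃ L₀ : ℕ, 0 < C₁ ∧ ∀ β : ℝ, 1 ≤ β →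
      ∀ μ ∈ Set.Icc μ₁ μ₂, ∀ (L : ℕ) [NeZero L], L₀ ≤ L → ∀ h : ℝ, |h| ≤ 1 / β →
        Real.log (partitionFn (β / 2) (dWaveSourceTorus L 0 μ h)).re / (β / 2 * (L : ℝ) ^ 2) -
            Real.log (partitionFn β (dWaveSourceTorus L 0 μ h)).re / (β * (L : ℝ) ^ 2) ≤
          C₁ / β ^ 2) := by
  intro H
  obtain ⟨C₁, L₀, hC₁, H⟩ := H (-1) (-1) (by norm_num) le_rfl (by norm_num)
  set j : ℕ := max L₀ 1 with hjdef
  have hj : 1 ≤ j := le_max_right _ _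
  set L : ℕ := 3 * j with hLdef
  have hL3 : 3 ≤ L := by omega
  have hL₀ : L₀ ≤ L := by omega
  haveI : NeZero L := ⟨by omega⟩
  have hL2 : (0 : ℝ) < (L : ℝ) ^ 2 := cast_sq_pos_of_neZero L
  have hlog2 : 0 < Real.log 2 := Real.log_pos one_lt_two
  set β : ℝ := C₁ * (L : ℝ) ^ 2 / Real.log 2 + 1 with hβ
  have hβ1 : 1 ≤ β := by
    have : 0 ≤ C₁ * (L : ℝ) ^ 2 / Real.log 2 := by positivity
    linarith
  have hβpos : 0 < β := by linarith
  have key := H β hβ1 (-1) ⟨le_rfl, le_rfl⟩ L hL₀ 0 (by rw [abs_zero]; positivity)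
  have hq : torusBand L (![((j : ℕ) : ZMod (3 * j)), 0] : TorusSite 2 (3 * j)) = -1 :=
    Summit.HubbardSuperconductivity.HubbardSuperconductivity.Theorems.TwSourcedInertness.Negative.torusBand_qOn hj
  have hfloor := free_heatChord_ge_of_zeroMode L hL3 _ hq hβpos
  -- `2 log 2/(βL²) ≤ C₁/β²` is impossible for this `β`
  have h1 : 2 * Real.log 2 / (β * (L : ℝ) ^ 2) ≤ C₁ / β ^ 2 := hfloor.trans key
  rw [div_le_div_iff₀ (by positivity) (by positivity)] at h1
  -- `2 log 2 · β² ≤ C₁ β L²` i.e. `2 log 2 · β ≤ C₁ L²`, but `β log 2 = C₁L² + log 2`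
  have h2 : 2 * Real.log 2 * β ≤ C₁ * (L : ℝ) ^ 2 := by
    have := h1
    nlinarith
  have h3 : Real.log 2 * β = C₁ * (L : ℝ) ^ 2 + Real.log 2 := by
    rw [hβ]; field_simp
  nlinarith

end Summit.HubbardSuperconductivity.HubbardSuperconductivity.Theorems.TwSourcedCondensation.Negative
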